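import Summits.CriticalPhenomena.CardyFormulaZ2.Theorems.CardyMagicRigidityMarkovCascadeDefs
import Literature.Probability.Percolation.LoopBoundaryRegularity

/-!
# Big interface loops of bond-`ℤ²` have a top corner (helper toward `tight_encard_bigLoops_bondLoopConfig`)

Helper module (Part 1) of the stub `tight_encard_bigLoops_bondLoopConfig`
(`Theorems/CardyMagicRigidityNestingRigidityBigLoopsTightZ2.lean`) of line
`markov-cascade-one-generation` of crux `NestingRigidity` (stmt-CriticalPhenomena-4835): the
deterministic planar combinatorics behind the tightness of the number of macroscopic interface
loops of critical bond percolation on `ℤ²` (no probability here; no `def`, no named fact).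

**Theorem** (`exists_topCorner_of_isInterfaceLoop`, mesh `1`). Let `γ` be an interface loop of a
lattice configuration `ω ⊆ E(ℤ²)` whose trace lies in `B(0, B)` and has diameter `≥ D ≥ 4s + 2`.
* If `γ` winds counter-clockwise (type `1`), let `K` be the open cluster of its rim (left vertices),
  which lies inside `γ` (`W = 1`), and let `x` be the highest site of `K` (second coordinate, ties
  broken lexicographically: the top of `K` for `SiteBelow ![0, 1]`). Then `x` is a local top of `ω`
  at scale `s` in the direction `(0, 1)` (`IsLocalTop`, `ClusterExtremalPoints.lean`), AND the dart
  of the corner `(x, 0)` (left vertex `x`, right face the face above-right of `x`) belongs to `γ`: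
  the trace stays below height `x₁ + ½`, so the centre of that face sees infinity along a vertical
  ray missing the trace (`W = 0` there), and the jump relation across the corner forces the dart
  onto the loop.
* If `γ` winds clockwise (type `0`), the same holds for the dual-open cluster of its right faces,
  the dual configuration `dualConfig ω`, the highest face `g`, and the corner `(g + e₁, 3)` (left
  vertex the upper-left corner of `g`, right face `g`).

Since distinct loops of one configuration have disjoint dart sets, the loop ↦ top-corner map is
injective; this is how the number of big loops is bounded by the number of local tops, whose
expectation is `O(area / s²)` (`real_localTopEvent_le`), in the main stub file.

References: P. Nolin, Electron. J. Probab. 13 (2008), §5.2 (counting argument for `β₃ = 2`);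
G. Grimmett, *Percolation* (1999), §11.2; F. Camia, C. M. Newman, CMP 268 (2006), §4.
-/

noncomputable section

open MeasureTheory Set Filter
open scoped Topology BigOperators ENNReal Real

namespace Summit.CriticalPhenomena.CardyFormulaZ2.Cruxes.NestingRigidity.MarkovCascadeOneGeneration

open Literature.Probability.RandomPlanarGeometry Literature.Probability.Percolation
  Literature.Probability.LatticeModels SimpleGraph
open Summit.CriticalPhenomena.CardyFormulaZ2.Theses.CardyMagicRigidity

/-! ### The vertical direction `(0, 1)` and its strict order `SiteBelow ![0, 1]` -/

/-- The height in the direction `(0, 1)` is the second coordinate. [folklore] -/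
theorem siteHeight_up (x : Site 2) : siteHeight ![0, 1] x = x 1 := by
  simp [siteHeight]

/-- A site strictly below `x` for `SiteBelow ![0, 1]` is not higher than `x`. [folklore] -/
theorem apply_one_le_of_siteBelow_up {y x : Site 2} (h : SiteBelow ![0, 1] y x) : y 1 ≤ x 1 := by
  rcases h with h | ⟨h, -⟩
  · rw [siteHeight_up, siteHeight_up] at h
    exact_mod_cast h.le
  · rw [siteHeight_up, siteHeight_up] at h
    exact_mod_cast h.le

/-- **The highest site of a bounded open cluster is a local top in the direction `(0, 1)`.** If the
open cluster of `v₀` (lattice configuration `ω'`) is contained in the finite set `K` and contains,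
for every site `x`, a site at sup-distance `≥ s` from `x`, then its top `x` for `SiteBelow ![0, 1]`
is a `(0,1)`-top at scale `s` (`IsLocalTop`), and no site of the cluster is higher than `x`.
[cite: Nolin2008, §5.2, proof of Thm 23 (arXiv 0711.4948 numbering; counting argument)] -/
theorem exists_isLocalTop_up {ω' : BondConfig (Site 2)} (hω' : ω' ⊆ (zdGraph 2).edgeSet)
    {v₀ : Site 2} {s : ℕ} (hs : 1 ≤ s) (K : Finset (Site 2))
    (hK : ∀ y, (openGraph ω').Reachable v₀ y → y ∈ K)
    (hfar : ∀ x : Site 2, ∃ v, (openGraph ω').Reachable v₀ v ∧ ∃ i, (s : ℤ) ≤ |v i - x i|) :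
    ∃ x, (openGraph ω').Reachable v₀ x ∧ (∀ y, (openGraph ω').Reachable v₀ y → y 1 ≤ x 1) ∧
      IsLocalTop ![0, 1] ω' x s := by
  classical
  set K' := K.filter fun y ↦ (openGraph ω').Reachable v₀ y with hK'
  have hmem : ∀ y, (openGraph ω').Reachable v₀ y ↔ y ∈ K' := fun y ↦ by
    rw [hK', Finset.mem_filter]
    exact ⟨fun h ↦ ⟨hK y h, h⟩, fun h ↦ h.2⟩
  have hne : K'.Nonempty := ⟨v₀, (hmem v₀).1 (Reachable.refl _)⟩
  obtain ⟨x, hx, htop⟩ := exists_isTop_siteBelow ![0, 1] hne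
  have hx' : (openGraph ω').Reachable v₀ x := (hmem x).2 hx
  refine ⟨x, hx', fun y hy ↦ ?_, ?_, ?_⟩
  · by_cases hyx : y = x
    · rw [hyx]
    · exact apply_one_le_of_siteBelow_up (htop y ((hmem y).1 hy) hyx)
  · obtain ⟨v, hv, hvfar⟩ := hfar x
    exact exists_siteSphere_reachable hω' hs (hx'.symm.trans hv) hvfar
  · intro y hy hyx
    have hy' : (openGraph ω').Reachable v₀ y :=
      hx'.trans (hy.mono (localOpenGraph_le_openGraph ω' x s))
    exact htop y ((hmem y).1 hy') hyx

/-! ### A point above the trace is outside the loop -/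

/-- **Vertical rays to infinity.** If the trace of an interface loop lies in the closed lower
half-plane `im ≤ H`, then every point `z` off the trace with `im z ≥ H` has winding number `0`:
the upward vertical segment from `z` to a far point misses the trace. [folklore] -/
theorem wind_eq_zero_of_forall_im_le {ω : BondConfig (Site 2)} {γ : List MedialVertex}
    (h : IsInterfaceLoop ω γ) {H : ℝ} (htr : ∀ p ∈ (loopCurve 1 0 γ).range, p.im ≤ H) {z : ℂ}
    (hz : H ≤ z.im) (hzr : z ∉ (loopCurve 1 0 γ).range) : (loopCurve 1 0 γ).wind z = 0 := by
  set c := loopCurve 1 0 γ with hc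
  obtain ⟨ρ, hρpos, hρ⟩ : ∃ ρ : ℝ, 0 < ρ ∧ c.range ⊆ Metric.ball z ρ := by
    obtain ⟨ρ, hρ⟩ := c.isCompact_range.isBounded.subset_ball z
    exact ⟨max ρ 1, by positivity, hρ.trans (Metric.ball_subset_ball (le_max_left _ _))⟩
  set q : ℂ := z + (ρ : ℂ) * Complex.I with hq
  have hq0 : c.wind q = 0 := by
    refine c.wind_eq_zero_of_subset_ball hρ ?_
    rw [hq, dist_eq_norm]
    simp [Complex.norm_I, abs_of_pos hρpos]
  have hdisj : Disjoint (segment ℝ z q) c.range := by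
    rw [Set.disjoint_left]
    intro w hw hwr
    rw [segment_eq_image'] at hw
    obtain ⟨t, ⟨ht0, -⟩, rfl⟩ := hw
    rcases eq_or_lt_of_le ht0 with rfl | ht0'
    · simp only [zero_smul, add_zero] at hwr
      exact hzr hwr
    · have h1 := htr _ hwr
      have h2 : (z + t • (q - z)).im = z.im + t * ρ := by
        rw [hq, Complex.add_im, Complex.smul_im]
        simp
      rw [h2] at h1
      have : 0 < t * ρ := mul_pos ht0' hρpos
      linarith
  rw [c.wind_eq_of_segment_disjoint (isLoop_loopCurve 1 0 h.ne_nil) hdisj, hq0]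

/-! ### The top corner of a big interface loop -/

/-- **Every macroscopic interface loop has a top corner, which is a local top of the primal or of
the dual configuration.** Let `γ` be an interface loop of a lattice configuration `ω ⊆ E(ℤ²)`
(mesh `1`) with trace in `B(0, B)` and diameter `≥ D ≥ 4s + 2`, `s ≥ 1`. Either (counter-clockwise
loop) there is a site `x` with `‖x‖ < B` which is a local top of `ω` at scale `s` in the direction
`(0, 1)` and such that the dart of the corner `(x, 0)` lies on `γ`, or (clockwise loop) there is a
face `g` with `‖c_g‖ < B` which is a local top of `dualConfig ω` at scale `s` in the direction
`(0, 1)` and such that the dart of the corner `(g + e₁, 3)` (whose face is `g`) lies on `γ`.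
[cite: Nolin2008, §5.2, proof of Thm 23 (arXiv 0711.4948 numbering; counting argument)] -/
theorem exists_topCorner_of_isInterfaceLoop :
    ∀ (ω : BondConfig (Site 2)) (γ : List MedialVertex) (B D : ℝ) (s : ℕ),
      ω ⊆ (zdGraph 2).edgeSet → IsInterfaceLoop ω γ → 1 ≤ s → (4 * s + 2 : ℝ) ≤ D →
      (loopCurve 1 0 γ).range ⊆ Metric.ball 0 B → D ≤ Metric.diam (loopCurve 1 0 γ).range →
      (∃ x : Site 2, ‖meshPoint 1 x‖ < B ∧ IsLocalTop ![0, 1] ω x s ∧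
          (cSrc (x, 0), cTgt (x, 0)) ∈ γ.zip (γ.rotate 1)) ∨
      (∃ g : Site 2, ‖faceCenter g‖ < B ∧ IsLocalTop ![0, 1] (dualConfig ω) g s ∧
          (cSrc (g + Pi.single 1 1, 3), cTgt (g + Pi.single 1 1, 3)) ∈ γ.zip (γ.rotate 1)) := by
  intro ω γ B D s hω h hs hsD hB hD
  set c := loopCurve 1 0 γ with hc
  -- the corner of the first dart
  obtain ⟨p₀, hp₀s, hp₀t⟩ := h.exists_corner 0
  have hp₀s' : cSrc p₀ = γ[0]'h.length_pos := by
    rw [hp₀s]; exact IsInterfaceLoop.getElem_idx_congr (Nat.zero_mod _) _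
  have hp₀t' : cTgt p₀ = γ[1 % γ.length]'(Nat.mod_lt _ h.length_pos) := by rw [hp₀t]
  have hd₀ : (cSrc p₀, cTgt p₀) ∈ γ.zip (γ.rotate 1) := by
    rw [hp₀s, hp₀t]
    exact getElem_mem_zip_rotate (Nat.mod_lt 0 h.length_pos)
  have hjump := h.wind_sub_wind_cFace p₀
  rw [if_pos hd₀] at hjump
  -- non-zero winding number forces the point into the disc `B(0, B)`
  have hin : ∀ z, c.wind z ≠ 0 → ‖z‖ < B := fun z hz ↦ by
    by_contra hle
    push Not at hle
    exact hz (c.wind_eq_zero_of_subset_ball hB (by rwa [dist_zero_right]))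
  -- two far darts
  have hD0 : 0 ≤ D - 1 / 4 := by
    have : (1 : ℝ) ≤ s := by exact_mod_cast hs
    linarith
  have hpq : ∃ p ∈ c.range, ∃ q ∈ c.range, D - 1 / 4 < dist p q := by
    by_contra hcon
    push Not at hcon
    have := Metric.diam_le_of_forall_dist_le hD0 hcon
    linarith
  obtain ⟨p, hp, q, hq, hpq⟩ := hpq
  have hpq' : D - 5 / 4 < dist p q := by linarith
  obtain ⟨rp, hrp, hdp, hdp'⟩ := h.exists_corner_near hp
  obtain ⟨rq, hrq, hdq, hdq'⟩ := h.exists_corner_near hq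
  have hpos : (0 : ℝ) < Real.sqrt 2 / 4 := by positivity
  rcases h.wind_mem_and_loopSignedArea with ⟨hw, -⟩ | ⟨hw, -⟩
  · -- counter-clockwise: the primal cluster of the left vertices
    left
    have hW0 : c.wind (meshPoint 1 p₀.1) = 1 := by
      rcases hw (meshPoint 1 p₀.1) with h0 | h1
      · rcases hw (faceCenter (cFace p₀)) with h0' | h1' <;> omega
      · exact h1
    have hW : ∀ y, (openGraph ω).Reachable p₀.1 y → c.wind (meshPoint 1 y) = 1 := fun y hy ↦ by
      rw [← h.wind_eq_of_mem_openCluster hω hy, hW0]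
    have hball : ∀ y, (openGraph ω).Reachable p₀.1 y → ‖meshPoint 1 y‖ < B := fun y hy ↦
      hin _ (by rw [hW y hy]; exact one_ne_zero)
    have hfar : ∀ x : Site 2, ∃ v, (openGraph ω).Reachable p₀.1 v ∧ ∃ i, (s : ℤ) ≤ |v i - x i| := by
      intro x
      rcases exists_coord_ge_of_far hpq' hsD (fun a ↦ meshPoint 1 a) dist_meshPoint_le hdp hdq x
        with hfa | hfb
      · exact ⟨rp.1, (h.reachable_of_mem_zip hp₀s' hp₀t' hrp).1, hfa⟩
      · exact ⟨rq.1, (h.reachable_of_mem_zip hp₀s' hp₀t' hrq).1, hfb⟩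
    obtain ⟨x, hx, hmax, htop⟩ := exists_isLocalTop_up hω hs (box 2 ⌈B⌉₊)
      (fun y hy ↦ mem_box_ceil_of_norm_lt (hball y hy)) hfar
    refine ⟨x, hball x hx, htop, ?_⟩
    -- the trace stays below height `x 1 + 1/2`
    have htr : ∀ z ∈ c.range, z.im ≤ (x 1 : ℝ) + 1 / 2 := by
      intro z hz
      obtain ⟨r, hr, hdz, -⟩ := h.exists_corner_near hz
      have h1 : (r.1 1 : ℝ) ≤ x 1 := by
        exact_mod_cast hmax r.1 (h.reachable_of_mem_zip hp₀s' hp₀t' hr).1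
      have h2 : |z.im - (meshPoint 1 r.1).im| ≤ dist z (meshPoint 1 r.1) := by
        rw [Complex.dist_eq, ← Complex.sub_im]
        exact Complex.abs_im_le_norm _
      rw [meshPoint_im, one_mul] at h2
      have := (abs_le.1 (h2.trans hdz)).2
      linarith
    -- the face above-right of `x` is outside
    have hface : c.wind (faceCenter (cFace (x, 0))) = 0 := by
      refine wind_eq_zero_of_forall_im_le h htr ?_ fun hmem ↦ ?_
      · have : (faceCenter (cFace (x, (0 : Fin 4)))).im = (x 1 : ℝ) + 1 / 2 := by
          rw [faceCenter_im]
          simp [cFace, faceAt, cornerOff]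
        rw [this]
      · have h1 := h.le_infDist_faceCenter (cFace (x, 0))
        rw [Metric.infDist_zero_of_mem hmem] at h1
        linarith
    have hj := h.wind_sub_wind_cFace (x, 0)
    by_contra hnot
    rw [if_neg hnot] at hj
    change c.wind (meshPoint 1 x) - c.wind (faceCenter (cFace (x, 0))) = 0 at hj
    rw [hface, hW x hx] at hj
    norm_num at hj
  · -- clockwise: the dual cluster of the right faces
    right
    have hW0 : c.wind (faceCenter (cFace p₀)) = -1 := by
      rcases hw (faceCenter (cFace p₀)) with h0 | h1
      · rcases hw (meshPoint 1 p₀.1) with h0' | h1' <;> omega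
      · exact h1
    have hW : ∀ g, (openGraph (dualConfig ω)).Reachable (cFace p₀) g → c.wind (faceCenter g) = -1 :=
      fun g hg ↦ by rw [← h.wind_faceCenter_eq_of_mem_openCluster_dualConfig hg, hW0]
    have hball : ∀ g, (openGraph (dualConfig ω)).Reachable (cFace p₀) g → ‖faceCenter g‖ < B :=
      fun g hg ↦ hin _ (by rw [hW g hg]; norm_num)
    have hωd : dualConfig ω ⊆ (zdGraph 2).edgeSet := Set.sdiff_subset
    have hfar : ∀ x : Site 2, ∃ v, (openGraph (dualConfig ω)).Reachable (cFace p₀) v ∧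
        ∃ i, (s : ℤ) ≤ |v i - x i| := by
      intro x
      rcases exists_coord_ge_of_far hpq' hsD (fun a ↦ faceCenter a) dist_faceCenter_le hdp' hdq' x
        with hfa | hfb
      · exact ⟨cFace rp, (h.reachable_of_mem_zip hp₀s' hp₀t' hrp).2, hfa⟩
      · exact ⟨cFace rq, (h.reachable_of_mem_zip hp₀s' hp₀t' hrq).2, hfb⟩
    obtain ⟨g, hg, hmax, htop⟩ := exists_isLocalTop_up hωd hs (box 2 (⌈B⌉₊ + 1))
      (fun y hy ↦ mem_box_ceil_succ_of_norm_faceCenter_lt (hball y hy)) hfar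
    refine ⟨g, hball g hg, htop, ?_⟩
    -- the trace stays below height `g 1 + 1`
    have htr : ∀ z ∈ c.range, z.im ≤ (g 1 : ℝ) + 1 := by
      intro z hz
      obtain ⟨r, hr, -, hdz⟩ := h.exists_corner_near hz
      have h1 : ((cFace r) 1 : ℝ) ≤ g 1 := by
        exact_mod_cast hmax (cFace r) (h.reachable_of_mem_zip hp₀s' hp₀t' hr).2
      have h2 : |z.im - (faceCenter (cFace r)).im| ≤ dist z (faceCenter (cFace r)) := by
        rw [Complex.dist_eq, ← Complex.sub_im]
        exact Complex.abs_im_le_norm _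
      rw [faceCenter_im] at h2
      have := (abs_le.1 (h2.trans hdz)).2
      linarith
    -- the upper-left vertex of `g` is outside
    have hfaceg : cFace (g + Pi.single 1 1, 3) = g := by
      simp [cFace, faceAt, cornerOff]
    have hvert : c.wind (meshPoint 1 (g + Pi.single 1 1)) = 0 := by
      refine wind_eq_zero_of_forall_im_le h htr ?_ fun hmem ↦ ?_
      · rw [meshPoint_im, one_mul]
        simp
      · have h1 := h.le_infDist_meshPoint (g + Pi.single 1 1)
        rw [Metric.infDist_zero_of_mem hmem] at h1
        linarith
    have hj := h.wind_sub_wind_cFace (g + Pi.single 1 1, 3)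
    by_contra hnot
    rw [if_neg hnot] at hj
    change c.wind (meshPoint 1 (g + Pi.single 1 1)) -
      c.wind (faceCenter (cFace (g + Pi.single 1 1, 3))) = 0 at hj
    rw [hfaceg, hvert, hW g hg] at hj
    norm_num at hj

end Summit.CriticalPhenomena.CardyFormulaZ2.Cruxes.NestingRigidity.MarkovCascadeOneGeneration

end
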